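import Summits.NavierStokesRegularity.NavierStokesRegularity.Theses.AdaptedFrequency
import Literature.Analysis.FluidPDE.AdaptedBackwardKernel
import Literature.Analysis.FluidPDE.ClassicalSolution
import Mathlib.Analysis.Calculus.BumpFunction.SmoothApprox
import Mathlib.MeasureTheory.Function.ContinuousMapDense

/-!
# Crux `AdaptedFrequencyConverges` (stmt-NavierStokesRegularity-10493), line
  `cloud-frame-effective-tsai`: smooth nonnegative `L¹` approximation for STUB `stub_doeblin`

Helper file (theorems only; lands `--supports stmt-NavierStokesRegularity-10493`) for the
registered stub `stub_doeblin`. The block solver of the line takes smooth, compactly supported,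
nonnegative terminal data; the Doeblin step feeds it the positive and negative parts of the
difference of the two kernels, which are merely continuous and integrable. This file supplies the
approximation `doeblin_smooth_approx`: **every continuous integrable `g ≥ 0` on `ℝ³` is, for every
`θ > 0`, within `θ` in `L¹` of a `C^∞`, compactly supported, nonnegative `P`** — Mathlib's density
of compactly supported continuous functions in `L¹`
(`Integrable.exists_hasCompactSupport_integral_sub_le`), the positive part (which does not
increase the distance to `g ≥ 0`), and mollification by a normed bump
(`ContDiffBump.dist_normed_convolution_le`, `HasCompactSupport.contDiff_convolution_left`): the
mollified function is uniformly close on a fixed compact set, hence `L¹`-close.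
-/

noncomputable section

namespace Summit.NavierStokesRegularity.NavierStokesRegularity.Theorems.AdaptedFrequencyConverges.CloudFrameEffectiveTsai

open scoped Topology Convolution Pointwise
open Literature.Analysis.FluidPDE Set Filter MeasureTheory Function Metric

/-- **Mollification of a continuous compactly supported nonnegative function.** For `g₂ ≥ 0`
continuous with compact support and `θ > 0` there is a `C^∞`, compactly supported, nonnegative
`P` with `∫ |P − g₂| ≤ θ` (convolution with a normed bump of small radius: uniformly `η`-close by
uniform continuity, both functions vanish off a fixed ball of finite volume). -/
theorem doeblin_mollify {g₂ : EuclideanSpace ℝ (Fin 3) → ℝ} (hc : Continuous g₂)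
    (hs : HasCompactSupport g₂) (h0 : ∀ x, 0 ≤ g₂ x) {θ : ℝ} (hθ : 0 < θ) :
    ∃ P : EuclideanSpace ℝ (Fin 3) → ℝ, ContDiff ℝ (⊤ : ℕ∞) P ∧ HasCompactSupport P ∧
      (∀ x, 0 ≤ P x) ∧ Continuous P ∧ ∫ x, |P x - g₂ x| ≤ θ := by
  -- a ball containing the support, fattened by one
  obtain ⟨ρK, hρK⟩ := hs.isCompact.isBounded.subset_closedBall (0 : EuclideanSpace ℝ (Fin 3))
  obtain ⟨𝔅, h𝔅⟩ : ∃ 𝔅 : Set (EuclideanSpace ℝ (Fin 3)), 𝔅 = closedBall 0 (|ρK| + 1) := ⟨_, rfl⟩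
  have h𝔅m : MeasurableSet 𝔅 := by rw [h𝔅]; exact measurableSet_closedBall
  have h𝔅f : volume 𝔅 ≠ ⊤ := by rw [h𝔅]; exact measure_closedBall_lt_top.ne
  obtain ⟨V, hV⟩ : ∃ V : ℝ, V = volume.real 𝔅 := ⟨_, rfl⟩
  have hV0 : 0 ≤ V := by rw [hV]; exact measureReal_nonneg
  obtain ⟨η, hη⟩ : ∃ η : ℝ, η = θ / (V + 1) := ⟨_, rfl⟩
  have hη0 : 0 < η := by rw [hη]; positivity
  have hηV : η * V ≤ θ := by
    rw [hη, div_mul_eq_mul_div, div_le_iff₀ (by positivity)]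
    nlinarith [hθ]
  -- uniform continuity
  have huc : UniformContinuous g₂ := hs.uniformContinuous_of_continuous hc
  obtain ⟨δ, hδ, hδuc⟩ := Metric.uniformContinuous_iff.1 huc η hη0
  -- the bump
  have hr : 0 < min δ 1 := lt_min hδ one_pos
  let φ : ContDiffBump (0 : EuclideanSpace ℝ (Fin 3)) :=
    ⟨min δ 1 / 2, min δ 1, by positivity, by linarith⟩
  obtain ⟨P, hP⟩ : ∃ P : EuclideanSpace ℝ (Fin 3) → ℝ,
      P = (φ.normed volume ⋆[ContinuousLinearMap.lsmul ℝ ℝ, volume] g₂) := ⟨_, rfl⟩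
  have hPsm : ContDiff ℝ (⊤ : ℕ∞) P := by
    rw [hP]
    exact φ.hasCompactSupport_normed.contDiff_convolution_left _ φ.contDiff_normed
      (hc.locallyIntegrable (μ := volume))
  have hPcs : HasCompactSupport P := by
    rw [hP]; exact φ.hasCompactSupport_normed.convolution _ hs
  have hP0 : ∀ x, 0 ≤ P x := fun x => by
    rw [hP, convolution_def]
    exact integral_nonneg fun t => by
      simp only [ContinuousLinearMap.lsmul_apply, smul_eq_mul]
      exact mul_nonneg (φ.nonneg_normed t) (h0 _)
  -- uniform closeness
  have hclose : ∀ a, |P a - g₂ a| ≤ η := by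
    intro a
    have h := φ.dist_normed_convolution_le (μ := volume) (x₀ := a) (ε := η)
      hc.aestronglyMeasurable (fun x hx => (hδuc ?_).le)
    · rw [hP, ← Real.dist_eq]; exact h
    · exact (mem_ball.1 hx).trans_le (min_le_left _ _)
  -- supports
  have hg₂supp : ∀ a, a ∉ 𝔅 → g₂ a = 0 := by
    intro a ha
    by_contra hne
    have h1 : a ∈ closedBall (0 : EuclideanSpace ℝ (Fin 3)) ρK :=
      hρK (subset_tsupport _ (mem_support.2 hne))
    rw [h𝔅] at ha
    exact ha (closedBall_subset_closedBall (by linarith [le_abs_self ρK]) h1)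
  have hPsupp : ∀ a, a ∉ 𝔅 → P a = 0 := by
    intro a ha
    rw [h𝔅] at ha
    by_contra hne
    have h1 : a ∈ support (φ.normed volume) + support g₂ := by
      rw [hP] at hne
      exact support_convolution_subset _ (mem_support.2 hne)
    obtain ⟨x, hx, y, hy, rfl⟩ := Set.mem_add.1 h1
    rw [φ.support_normed_eq] at hx
    have hx' : ‖x‖ < 1 := by
      have := mem_ball_zero_iff.1 hx
      exact this.trans_le (min_le_right _ _)
    have hy' : ‖y‖ ≤ |ρK| := by
      have := mem_closedBall_zero_iff.1 (hρK (subset_tsupport _ hy))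
      exact this.trans (le_abs_self _)
    exact ha (mem_closedBall_zero_iff.2 ((norm_add_le x y).trans (by linarith)))
  -- the `L¹` bound
  have hpt : ∀ a, |P a - g₂ a| ≤ 𝔅.indicator (fun _ => η) a := by
    intro a
    by_cases ha : a ∈ 𝔅
    · rw [indicator_of_mem ha]; exact hclose a
    · rw [indicator_of_notMem ha, hPsupp a ha, hg₂supp a ha]; simp
  have hint : Integrable (𝔅.indicator fun _ => η) :=
    (integrableOn_const h𝔅f).integrable_indicator h𝔅m
  have hPi : Integrable P := hPsm.continuous.integrable_of_hasCompactSupport hPcs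
  have hg₂i : Integrable g₂ := hc.integrable_of_hasCompactSupport hs
  refine ⟨P, hPsm, hPcs, hP0, hPsm.continuous, ?_⟩
  calc ∫ x, |P x - g₂ x| ≤ ∫ x, 𝔅.indicator (fun _ => η) x :=
        integral_mono (hPi.sub hg₂i).abs hint hpt
    _ = η * V := by
        rw [integral_indicator h𝔅m, setIntegral_const, hV, smul_eq_mul, mul_comm]
    _ ≤ θ := hηV

/-- **Smooth nonnegative `L¹` approximation.** Every continuous integrable `g ≥ 0` on `ℝ³` is,
for every `θ > 0`, within `θ` in `L¹` of some `C^∞`, compactly supported, nonnegative (continuous,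
integrable) `P`. -/
theorem doeblin_smooth_approx {g : EuclideanSpace ℝ (Fin 3) → ℝ} (hgi : Integrable g)
    (hg0 : ∀ x, 0 ≤ g x) {θ : ℝ} (hθ : 0 < θ) :
    ∃ P : EuclideanSpace ℝ (Fin 3) → ℝ, ContDiff ℝ (⊤ : ℕ∞) P ∧ HasCompactSupport P ∧
      (∀ x, 0 ≤ P x) ∧ Continuous P ∧ Integrable P ∧ ∫ x, |P x - g x| ≤ θ := by
  -- compactly supported continuous approximation, then its positive part
  obtain ⟨g₁, hg₁s, hg₁d, hg₁c, hg₁i⟩ := hgi.exists_hasCompactSupport_integral_sub_le (half_pos hθ)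
  obtain ⟨g₂, hg₂⟩ : ∃ g₂ : EuclideanSpace ℝ (Fin 3) → ℝ, g₂ = fun x => max (g₁ x) 0 := ⟨_, rfl⟩
  have hg₂c : Continuous g₂ := by rw [hg₂]; exact hg₁c.max continuous_const
  have hg₂s : HasCompactSupport g₂ := by
    rw [hg₂]
    refine hg₁s.mono fun x hx => ?_
    rw [mem_support] at hx ⊢
    contrapose! hx
    rw [hx, max_self]
  have hg₂0 : ∀ x, 0 ≤ g₂ x := fun x => by rw [hg₂]; exact le_max_right _ _
  have hg₂i : Integrable g₂ := hg₂c.integrable_of_hasCompactSupport hg₂s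
  have hpt : ∀ x, |g₂ x - g x| ≤ ‖g x - g₁ x‖ := fun x => by
    rw [hg₂, Real.norm_eq_abs, abs_sub_comm (g x)]
    have h := abs_max_sub_max_le_abs (g₁ x) (g x) 0
    rwa [max_eq_left (hg0 x)] at h
  have hd₂ : ∫ x, |g₂ x - g x| ≤ θ / 2 :=
    (integral_mono (hg₂i.sub hgi).abs (hgi.sub hg₁i).norm hpt).trans hg₁d
  -- mollification
  obtain ⟨P, hPsm, hPcs, hP0, hPc, hPd⟩ := doeblin_mollify hg₂c hg₂s hg₂0 (half_pos hθ)
  have hPi : Integrable P := hPc.integrable_of_hasCompactSupport hPcs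
  refine ⟨P, hPsm, hPcs, hP0, hPc, hPi, ?_⟩
  have htri : ∀ x, |P x - g x| ≤ |P x - g₂ x| + |g₂ x - g x| := fun x => by
    have := abs_sub_le (P x) (g₂ x) (g x); linarith
  calc ∫ x, |P x - g x| ≤ ∫ x, (|P x - g₂ x| + |g₂ x - g x|) :=
        integral_mono (hPi.sub hgi).abs ((hPi.sub hg₂i).abs.add (hg₂i.sub hgi).abs) htri
    _ = (∫ x, |P x - g₂ x|) + ∫ x, |g₂ x - g x| :=
        integral_add (hPi.sub hg₂i).abs (hg₂i.sub hgi).abs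
    _ ≤ θ / 2 + θ / 2 := add_le_add hPd hd₂
    _ = θ := by ring


/-! ### Registered sub-goal -/

/-- **Registered sub-goal `stub_doeblin_approx`** (the explicit form of `doeblin_smooth_approx`):
an integrable `g ≥ 0` on `ℝ³` is `L¹`-approximable to any accuracy `θ > 0` by a `C^∞`, compactly
supported, nonnegative function — the terminal data the block solver of the line accepts. -/
theorem stub_doeblin_approx :
    ∀ (g : EuclideanSpace ℝ (Fin 3) → ℝ) (θ : ℝ), MeasureTheory.Integrable g → (∀ x, 0 ≤ g x) → 0 < θ → ∃ P : EuclideanSpace ℝ (Fin 3) → ℝ, ContDiff ℝ (⊤ : ℕ∞) P ∧ HasCompactSupport P ∧ (∀ x, 0 ≤ P x) ∧ Continuous P ∧ MeasureTheory.Integrable P ∧ ∫ x, |P x - g x| ≤ θ :=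
  fun _ _ hgi hg0 hθ => doeblin_smooth_approx hgi hg0 hθ

end Summit.NavierStokesRegularity.NavierStokesRegularity.Theorems.AdaptedFrequencyConverges.CloudFrameEffectiveTsai

end
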